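import Summits.Ventures.PercRepro2.CaseOneGadgetUWBPartsRel
import Summits.Ventures.PercRepro2.CaseOneGadgetUWBBlockIIQ13

/-!
# The gadget `u ~ {w, b}`, `w ~ {u, a₁, a₂, o}` (uwb): the identically-vanishing outer Bernstein blocks of `iiqB5`
(blind cell PercRepro2, p1 g34; the fourth gadget anchor of the six-form calculus — all six forms of the uwb gadget
as plain SFacts-cone certificate chains, generated by mining/p1/g37/uwb/chain/genb.py = p1 g36's genu3.py (uwa1b) re-targeted to uwb; p1 g33's gent_uwa1.py / g25's
geno.py re-targeted; P1-G33 §6–§6″, P1-G34)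

1 of the 60 present outer Bernstein blocks of `iiqB5` vanish identically (the gadget uwb: `u ~ {w, b}`, `w ~ {u, a₁, a₂, o}`; the masses vanish on faces of the cube in `e₀, e₁, e₂`, so several parts are linear combinations of the others). Each `epsBIIQ ijk_eq_zero` is the combination of the part relations (`CaseOneGadgetUWBPartsRel`) that the cell's generator found by exact linear algebra (mining/p1/g37/uwb/chain/genb.py); the Eps files use them as `le_of_eq`, so no cell certificate is needed on these blocks. -/

namespace Summit.Ventures.PercRepro2

namespace CaseOne

section ZeroRelBIIQ
variable {R : Type*} [CommRing R]



set_option maxHeartbeats 0 in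
/-- **The outer Bernstein block `(3,3,3)` of `iiqB5` vanishes identically** (by the part relations alone). -/
theorem epsBIIQ333_eq_zero (e₃ e₄ : R) (m : SCells R) : epsBIIQ333 e₃ e₄ m = 0 := by
  unfold epsBIIQ333 cfBIIQ010 cfBIIQ011 cfBIIQ012 cfBIIQ013 cfBIIQ100 cfBIIQ101 cfBIIQ102 cfBIIQ103 cfBIIQ110 cfBIIQ111 cfBIIQ112 cfBIIQ113 cfBIIQ120 cfBIIQ121 cfBIIQ122 cfBIIQ123 cfBIIQ210 cfBIIQ211 cfBIIQ212 cfBIIQ213 cfBIIQ220 cfBIIQ221 cfBIIQ222 cfBIIQ223 cfBIIQ230 cfBIIQ231 cfBIIQ232 cfBIIQ233 cfBIIQ320 cfBIIQ321 cfBIIQ322 cfBIIQ323 cfBIIQ330 cfBIIQ331 cfBIIQ332 cfBIIQ333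
  rw [pgBQABO111_rel, pgBQAB110_rel, pgBQAB111_rel, pgBQAO110_rel, pgBQB111_rel]
  ring

end ZeroRelBIIQ

end CaseOne

end Summit.Ventures.PercRepro2
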